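import Summits.ResolutionOfSingularities.ResolutionOfSingularities.Theorems.WeightedInvariantWeightedThesisHypersurfaceModelProjection
import HarnessLib

/-!
# `EquisingularLift.HypersurfacesSuffice` (crux stmt-ResolutionOfSingularities-15964), line
# `generic-projection-closure`, stub S3: the image ideal is trivial near the vertex

For a finite morphism `φ₀ : X → ℙ^{d+1}_k` avoiding the vertex `(0 : … : 0 : 1)`, the vertex has
an affine open neighbourhood `U` on which the kernel of `φ₀^* : Γ(ℙ^{d+1}, U) → Γ(X, φ₀⁻¹ U)` is
principal. Indeed `φ₀` is finite, hence universally closed, so its set-theoretic image is closed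
and misses the vertex; affine opens form a basis, so some affine open `U ∋ vertex` is disjoint
from the image; then `φ₀⁻¹ U = ∅`, `Γ(X, φ₀⁻¹ U)` is the zero ring, the kernel is the unit ideal
(`Scheme.Hom.ker_apply`, `φ₀` being quasi-compact), and the unit ideal is principal.

[folklore]
-/

noncomputable section

set_option linter.dupNamespace false -- mandated namespace of this single-conjunct summit

open CategoryTheory CategoryTheory.Limits AlgebraicGeometry TopologicalSpace Topology
open Literature.AlgebraicGeometry.Resolution Literature.AlgebraicGeometry.Motives
open Literature.AlgebraicGeometry.Morphisms.ProjCech (PP)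

namespace Summit.ResolutionOfSingularities.ResolutionOfSingularities.Theorems.HypersurfacesSuffice

universe u

/-- The kernel of `f^*` over an affine open `U` of the target whose preimage is empty is the unit
ideal: `Γ(X, f⁻¹ U) = Γ(X, ⊥)` is the zero ring. [folklore] -/
theorem ker_ideal_eq_top_of_preimage_eq_bot {X Y : Scheme.{u}} (f : X ⟶ Y) [QuasiCompact f]
    (U : Y.affineOpens) (hU : f ⁻¹ᵁ (U : Y.Opens) = ⊥) : f.ker.ideal U = ⊤ := by
  rw [Scheme.Hom.ker_apply, eq_top_iff]
  intro s _
  haveI : Subsingleton Γ(X, f ⁻¹ᵁ (U : Y.Opens)) :=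
    CommRingCat.subsingleton_of_isTerminal (X.sheaf.isTerminalOfEqEmpty hU)
  rw [RingHom.mem_ker]
  exact Subsingleton.elim _ _

/-- **S3 — the image ideal is trivial near the vertex.** For `φ₀ : X → ℙ^{d+1}_k` finite (hence
closed) avoiding the vertex, the vertex has an affine neighbourhood disjoint from the image, on
which the kernel of `φ₀^*` is the unit ideal, in particular principal. [folklore] -/
theorem stub_ker_isPrincipal_vertex : ∀ (d : ℕ) (k : Type) [Field k] (X : AlgebraicGeometry.Scheme.{0}) (φ₀ : X ⟶ Literature.AlgebraicGeometry.Morphisms.ProjCech.PP k (d + 1)) [AlgebraicGeometry.IsFinite φ₀], (∀ x : X, φ₀ x ≠ Literature.AlgebraicGeometry.Resolution.DeJong1996.vertex d k) → ∃ U : (Literature.AlgebraicGeometry.Morphisms.ProjCech.PP k (d + 1)).affineOpens, Literature.AlgebraicGeometry.Resolution.DeJong1996.vertex d k ∈ (U : (Literature.AlgebraicGeometry.Morphisms.ProjCech.PP k (d + 1)).Opens) ∧ (φ₀.ker.ideal U).IsPrincipal := by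
  intro d k _ X φ₀ _ hv
  -- the image of the finite (hence universally closed) `φ₀` is closed and misses the vertex
  have hcl : IsClosed (Set.range φ₀) := φ₀.isClosedMap.isClosed_range
  have hmem : DeJong1996.vertex d k ∈ (Set.range φ₀)ᶜ := by
    rintro ⟨x, hx⟩
    exact hv x hx
  -- an affine open neighbourhood of the vertex inside the (open) complement of the image
  obtain ⟨_, ⟨U, hU, rfl⟩, hxU, hUsub⟩ :=
    (PP k (d + 1)).isBasis_affineOpens.exists_subset_of_mem_open hmem hcl.isOpen_compl
  refine ⟨⟨U, hU⟩, hxU, ?_⟩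
  -- its preimage is empty, so the kernel over it is the unit ideal, which is principal
  have hpre : φ₀ ⁻¹ᵁ U = ⊥ := by
    ext x
    simp only [TopologicalSpace.Opens.map_coe, Set.mem_preimage, SetLike.mem_coe,
      TopologicalSpace.Opens.coe_bot, Set.mem_empty_iff_false, iff_false]
    exact fun hx => hUsub hx ⟨x, rfl⟩
  rw [ker_ideal_eq_top_of_preimage_eq_bot φ₀ ⟨U, hU⟩ hpre]
  infer_instance

end Summit.ResolutionOfSingularities.ResolutionOfSingularities.Theorems.HypersurfacesSuffice
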